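import Summits.Parity.GeneralizedHardyLittlewood.Theorems.LiouvilleShiftedTablesSieveToMAvgSizesEv

/-!
# Sieve glue for `SieveToMAvg`, part 12g: the core bound

Support file for item stmt-Parity-14274 (route `LiouvilleShiftedTables`).  THE CORE THEOREM
(`core_eventually`): if the dilated-table hypothesis `HypII Y (−h) δ (4·16421)` and the bilinear
hypothesis `HypI2 Y (−h) h ρ (2·20536) C₂` hold for all large `Y` (`0 < δ ≤ 1/12`, `4δ ≤ ρ`), then for
all large `Y` and every level `Q ≤ Y^{δ/4}`

  `CoreSum h Q Y = ∑_{q ≤ Q} |∑_{h < n ≤ Y, n ≡ h (q)} Λ(n) λ(n−h)| ≤ Y / (log Y)^6`.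

Assembly of parts 10a (split), 10b (Heath-Brown at each dyadic scale), 12b (`ScaleOK`), 12e–12f
(constants and sizes): `≤ log Y` dyadic scales each contribute `≤ 26262 · Y/(log Y)^9`, the initial
segment and the non-coprime moduli `≤ Y/(log Y)^7` each.
-/

namespace Summit.Parity.GeneralizedHardyLittlewood.Theorems.SieveToMAvg

open Finset Real Filter
open scoped ArithmeticFunction.zeta ArithmeticFunction.sigma ArithmeticFunction.vonMangoldt
open Literature.NumberTheory.Sieve.BVMoebius (eventually_log_rpow_le_rpow')

/-- Arithmetic of one dyadic bracket: `c · (lg · (Kr (b₁ + b₂) + sl)) ≤ 8754 Y/L⁹` when `c ≤ 3`,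
`lg ≤ 2L`, `Kr ≤ 729 L⁶`, `b₁, b₂ ≤ Y/L^{16}`, `sl ≤ Y/L^{10}` (all nonnegative, `L ≥ 1`). [folklore] -/
theorem bracket_le {L Y lg Kr b₁ b₂ sl c : ℝ} (hL : 1 ≤ L) (hY : 0 ≤ Y) (hlg0 : 0 ≤ lg) (hlg : lg ≤ 2 * L)
    (hKr0 : 0 ≤ Kr) (hKr : Kr ≤ 729 * L ^ 6) (hb₁ : b₁ ≤ Y / L ^ 16) (hb₂ : b₂ ≤ Y / L ^ 16)
    (hsl : sl ≤ Y / L ^ 10) (hb₁0 : 0 ≤ b₁) (hb₂0 : 0 ≤ b₂) (hsl0 : 0 ≤ sl) (hc : c ≤ 3) :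
    c * (lg * (Kr * (b₁ + b₂) + sl)) ≤ 8754 * (Y / L ^ 9) := by
  have hL0 : 0 < L := by linarith
  have hu0 : 0 ≤ Y / L ^ 10 := by positivity
  have h1 : Kr * (b₁ + b₂) ≤ 729 * L ^ 6 * (2 * (Y / L ^ 16)) :=
    mul_le_mul hKr (by linarith) (by positivity) (by positivity)
  have h1' : 729 * L ^ 6 * (2 * (Y / L ^ 16)) = 1458 * (Y / L ^ 10) := by
    field_simp; ring
  have h2 : Kr * (b₁ + b₂) + sl ≤ 1459 * (Y / L ^ 10) := by linarith
  have h3 : lg * (Kr * (b₁ + b₂) + sl) ≤ 2 * L * (1459 * (Y / L ^ 10)) :=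
    mul_le_mul hlg h2 (by positivity) (by positivity)
  have h3' : 2 * L * (1459 * (Y / L ^ 10)) = 2918 * (Y / L ^ 9) := by
    field_simp; ring
  have h4 : 0 ≤ Y / L ^ 9 := by positivity
  calc c * (lg * (Kr * (b₁ + b₂) + sl)) ≤ 3 * (2918 * (Y / L ^ 9)) := by
        refine mul_le_mul hc (h3.trans h3'.le) (by positivity) (by norm_num)
    _ = 8754 * (Y / L ^ 9) := by ring

/-- `k0f Y ≤ log Y` for large `Y`. [folklore] -/
theorem k0f_le_log_eventually : ∀ᶠ Y : ℝ in atTop, (k0f Y : ℝ) ≤ Real.log Y := by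
  have hlog : Tendsto (fun Y : ℝ => Real.log Y) atTop atTop := Real.tendsto_log_atTop
  have hll : ∀ᶠ t : ℝ in atTop, ‖Real.log t‖ ≤ 1 / 40 * ‖t‖ := Real.isLittleO_log_id_atTop.bound (by norm_num)
  filter_upwards [hlog.eventually hll, hlog.eventually_ge_atTop 3] with Y hY hL3
  have hL1 : 1 ≤ Real.log Y := by linarith
  refine (k0f_le hL1).trans ?_
  rw [Real.norm_eq_abs, Real.norm_eq_abs, abs_of_pos (by linarith : 0 < Real.log Y)] at hY
  have h1 : Real.log (Real.log Y) ≤ 1 / 40 * Real.log Y := (le_abs_self _).trans hY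
  have hl2 : 1 / 2 < Real.log 2 := by have := Real.log_two_gt_d9; linarith
  have h2 : Real.log (Real.log Y) / Real.log 2 ≤ (1 / 40 * Real.log Y) / (1 / 2) := by
    have h0 : 0 ≤ Real.log (Real.log Y) := Real.log_nonneg (by linarith)
    calc Real.log (Real.log Y) / Real.log 2 ≤ Real.log (Real.log Y) / (1 / 2) :=
          div_le_div_of_nonneg_left h0 (by norm_num) hl2.le
      _ ≤ (1 / 40 * Real.log Y) / (1 / 2) := div_le_div_of_nonneg_right h1 (by norm_num)
  linarith

section Core

variable {h : ℕ} {δ ρ C₂ : ℝ}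

/-- **The core bound.** See the module docstring. [folklore] -/
theorem core_eventually (hh : 1 ≤ h) (hδ : 0 < δ) (hδ12 : δ ≤ 1 / 12) (hδρ : 4 * δ ≤ ρ) (hC₂ : 0 ≤ C₂)
    (hII : ∀ᶠ Y : ℝ in atTop, HypII Y (-(h : ℤ)) δ (((4 * 16421 : ℕ) : ℝ)))
    (hI2 : ∀ᶠ Y : ℝ in atTop, HypI2 Y (-(h : ℤ)) h ρ (((2 * 20536 : ℕ) : ℝ)) C₂) :
    ∀ᶠ Y : ℝ in atTop, ∀ Q : ℕ, (Q : ℝ) ≤ Y ^ (δ / 4) → CoreSum h Q Y ≤ Y / Real.log Y ^ 6 := by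
  classical
  obtain ⟨Cτ, hCτ, hD⟩ := exists_divisor_consts
  obtain ⟨C', hC', hD'⟩ := exists_Dtau'_const
  obtain ⟨C_φ, hCφ, hφ⟩ := exists_totient_const
  obtain ⟨C_S, x₀S, hCS, hSh⟩ := exists_shiu_consts
  obtain ⟨Cτ1, hCτ1, hD1⟩ := exists_Dtau_le 1
  have hlog : Tendsto (fun Y : ℝ => Real.log Y) atTop atTop := Real.tendsto_log_atTop
  have hh0 : (0 : ℝ) < h := by exact_mod_cast hh
  filter_upwards [scaleOK_eventually hδ hδ12 hδρ (A₁ := 8210) (by norm_num), BII_small_eventually hδ hδ12 hCτ,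
    BI2_small_eventually hδ hδ12 hCτ hC' hC₂ hD', SLIV_small_eventually hδ hδ12 h hCφ hCS hφ hSh, hII, hI2,
    hlog.eventually_ge_atTop (200 + 16 * Cτ1), k0f_le_log_eventually, tendsto_lowScale.eventually_ge_atTop (h : ℝ),
    eventually_log_rpow_le_rpow' ((9 : ℕ) : ℝ) (by norm_num : (0 : ℝ) < 1 / 4),
    (tendsto_rpow_atTop (by norm_num : (0 : ℝ) < 1 / 4)).eventually_ge_atTop (3 * h),
    ((tendsto_pow_atTop (by norm_num : (8210 : ℕ) ≠ 0)).comp hlog).eventually_ge_atTop 2,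
    Filter.eventually_ge_atTop (4 : ℝ)]
    with Y hOK hBII hBI2 hSLIV hypII hypI2 hL hk₀L hloh hL9 h3h hLA hY4 Q hQ
  set L := Real.log Y with hLdef
  have hY0 : 0 < Y := by linarith
  have hY1 : 1 ≤ Y := by linarith
  have hL200 : 200 ≤ L := by linarith [show (0 : ℝ) ≤ 16 * Cτ1 by positivity]
  have hL1 : 1 ≤ L := by linarith
  have hL0 : 0 < L := by linarith
  have hLp : ∀ n : ℕ, 0 < L ^ n := fun n => pow_pos hL0 n
  have hLA' : 2 ≤ L ^ 8210 := by simpa using hLA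
  have hCτ0 : 0 ≤ Cτ := by linarith
  have hYpow : ∀ a b : ℝ, Y ^ a * Y ^ b = Y ^ (a + b) := fun a b => (Real.rpow_add hY0 a b).symm
  -- trivial level
  rcases Nat.eq_zero_or_pos Q with hQ0 | hQpos
  · subst hQ0
    have : CoreSum h 0 Y = 0 := by unfold CoreSum; simp
    rw [this]; positivity
  have hQ1 : 1 ≤ Q := hQpos
  -- the dyadic depth
  obtain ⟨hk1, hk2⟩ := two_pow_k0f_bounds hL1
  have hN₀ : (h : ℝ) ≤ Y / 2 ^ k0f Y := by
    refine hloh.trans (div_le_div_of_nonneg_left hY0.le (by positivity) hk2)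
  have hk₀ : h ≤ ⌊Y / 2 ^ k0f Y⌋₊ := Nat.le_floor hN₀
  have hsplit := CoreSum_le_split hh Q hY1 hk₀
  -- Term A: non-coprime moduli
  have hA : (Q : ℝ) * (h * (Nat.log 2 ⌊Y⌋₊ + 1) * Real.log Y) ≤ Y / L ^ 7 := by
    have hlog2 : (Nat.log 2 ⌊Y⌋₊ : ℝ) ≤ 2 * L := by
      have := Kbf_le hY1; unfold Kbf at this; push_cast at this; linarith
    have hL9' : L ^ 9 ≤ Y ^ ((1 : ℝ) / 4) := by
      have e : L ^ 9 = L ^ (((9 : ℕ) : ℝ)) := (Real.rpow_natCast _ _).symm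
      rw [e]; exact hL9
    rw [le_div_iff₀ (hLp 7)]
    calc (Q : ℝ) * (h * (Nat.log 2 ⌊Y⌋₊ + 1) * Real.log Y) * L ^ 7
        ≤ Y ^ (δ / 4) * (h * (2 * L + 1) * L) * L ^ 7 := by gcongr
      _ ≤ Y ^ (δ / 4) * (h * (3 * L) * L) * L ^ 7 := by gcongr; linarith
      _ = Y ^ (δ / 4) * ((3 * h) * L ^ 9) := by ring
      _ ≤ Y ^ (δ / 4) * (Y ^ ((1 : ℝ) / 4) * Y ^ ((1 : ℝ) / 4)) :=
          mul_le_mul_of_nonneg_left (mul_le_mul h3h hL9' (by positivity) (by positivity)) (by positivity)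
      _ = Y ^ (δ / 4 + 1 / 2) := by rw [hYpow, hYpow]; norm_num
      _ ≤ Y ^ (1 : ℝ) := Real.rpow_le_rpow_of_exponent_le hY1 (by linarith)
      _ = Y := Real.rpow_one Y
  -- Term B: the initial segment
  have hB : ∑ n ∈ Ioc h ⌊Y / 2 ^ k0f Y⌋₊, (σ 0 (n - h) : ℝ) * Λ n ≤ Y / L ^ 7 := by
    set N₀ := ⌊Y / 2 ^ k0f Y⌋₊ with hN₀def
    have hN1 : 1 ≤ N₀ := le_trans hh hk₀
    have hN1' : (1 : ℝ) ≤ N₀ := by exact_mod_cast hN1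
    have hNY : (N₀ : ℝ) ≤ Y / L ^ 13 := (Nat.floor_le (by positivity)).trans (init_height_le hY0.le hL1)
    have hNY' : (N₀ : ℝ) ≤ Y := hNY.trans (div_le_self hY0.le (one_le_pow₀ hL1))
    have hlogN : Real.log N₀ ≤ L := Real.log_le_log (by linarith) hNY'
    have hlogN0 : 0 ≤ Real.log N₀ := Real.log_nonneg hN1'
    refine (init_le h hN1).trans ?_
    have hDN : Dtau 1 N₀ ≤ Cτ1 * N₀ * (1 + Real.log N₀) ^ (2 ^ (1 + 1)) := hD1 N₀ hN1'
    rw [show (2 : ℕ) ^ (1 + 1) = 4 by norm_num] at hDN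
    calc Real.log N₀ * Dtau 1 N₀ ≤ L * (Cτ1 * N₀ * (1 + Real.log N₀) ^ 4) :=
          mul_le_mul hlogN hDN (Dtau_nonneg 1 _) hL0.le
      _ ≤ L * (Cτ1 * (Y / L ^ 13) * (2 * L) ^ 4) := by gcongr; linarith
      _ = 16 * Cτ1 * (Y / L ^ 8) := by field_simp; ring
      _ ≤ L * (Y / L ^ 8) := mul_le_mul_of_nonneg_right (by linarith) (by positivity)
      _ = Y / L ^ 7 := by rw [show (8 : ℕ) = 7 + 1 from rfl, pow_succ, ← div_div, mul_div_cancel₀ _ hL0.ne']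
  -- Term C: the dyadic scales
  have hKff : 2 * Y ≤ (1 + Δf 8210 Y) ^ Kff 8210 Y := two_mul_le_pow_Kff (by linarith) (Δf_bounds hLA').1
  have hKb : (Kbf Y : ℝ) ≤ 3 * L := by have := Kbf_le hY1; linarith
  have hC : ∀ k ∈ Finset.range (k0f Y),
      TT (lamW h) h Q (Y / 2 ^ (k + 1)) (fun n => (Λ n : ℝ)) ≤ 26262 * (Y / L ^ 9) := by
    intro k hk
    obtain ⟨hxlo, hxY⟩ := dyadic_scale_bounds hY0.le hL1 (Finset.mem_range.1 hk)
    set x := Y / 2 ^ (k + 1) with hxdef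
    have hx1 : 1 ≤ x := (hOK Q hQ x hxlo hxY 1 (by simp)).hx
    have hTT := TT_dyadic_le (K := Kbf Y) hypII hypI2 (hOK Q hQ x hxlo hxY) (lt_of_lt_of_le (by linarith) hKff) hCτ0 hD
      (lt_two_pow_Kbf hxY)
    refine hTT.trans ?_
    have hterm : ∀ j ∈ Icc 1 3, (Nat.choose 3 j : ℝ) * (Real.log (⌊2 * x⌋₊ + 1 : ℕ) *
        ((Kbf Y : ℝ) ^ (2 * j) * (BII j x Y (((4 * 16421 : ℕ) : ℝ)) Cτ 8192 (Kff 8210 Y) Q +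
          BI2 j x Y (Δf 8210 Y) (((2 * 20536 : ℕ) : ℝ)) C₂ Cτ (1 / 3 + δ / 2) 8192 (Kff 8210 Y) Q) +
          SLIV j h Q x (Δf 8210 Y))) ≤ 8754 * (Y / L ^ 9) := by
      intro j hj
      obtain ⟨hj1, hj3⟩ := Finset.mem_Icc.1 hj
      have hchoose : (Nat.choose 3 j : ℝ) ≤ 3 := by
        have : Nat.choose 3 j ≤ 3 := by interval_cases j <;> decide
        exact_mod_cast this
      have hlg : Real.log (⌊2 * x⌋₊ + 1 : ℕ) ≤ 2 * L := by
        have h1 : ((⌊2 * x⌋₊ + 1 : ℕ) : ℝ) ≤ 2 * Y := by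
          push_cast; linarith [Nat.floor_le (by linarith : 0 ≤ 2 * x)]
        have h2 : Real.log (⌊2 * x⌋₊ + 1 : ℕ) ≤ Real.log (2 * Y) := Real.log_le_log (by positivity) h1
        rw [Real.log_mul (by norm_num) hY0.ne'] at h2
        have : Real.log 2 < 1 := by have := Real.log_two_lt_d9; linarith
        linarith
      have hlg0 : 0 ≤ Real.log (⌊2 * x⌋₊ + 1 : ℕ) := Real.log_nonneg (by exact_mod_cast Nat.le_add_left 1 _)
      have hKr : (Kbf Y : ℝ) ^ (2 * j) ≤ 729 * L ^ 6 := by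
        calc (Kbf Y : ℝ) ^ (2 * j) ≤ (3 * L) ^ (2 * j) := pow_le_pow_left₀ (Nat.cast_nonneg _) hKb _
          _ ≤ (3 * L) ^ 6 := pow_le_pow_right₀ (by linarith) (by omega)
          _ = 729 * L ^ 6 := by ring
      exact bracket_le hL1 hY0.le hlg0 hlg (by positivity) hKr (hBII Q hQ1 hQ x hxlo hxY j hj)
        (hBI2 Q hQ1 hQ x hxlo hxY j hj) (hSLIV Q hQ1 hQ x hxlo hxY j hj)
        (BII_nonneg j (by linarith) hY1 hCτ0 _ _ _) (BI2_nonneg j (by linarith) (Δf_bounds hLA').1.le hCτ0 _ _ _)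
        (Finset.sum_nonneg fun _ _ => Finset.sum_nonneg fun _ _ => by positivity) hchoose
    calc _ ≤ ∑ j ∈ Icc 1 3, 8754 * (Y / L ^ 9) := Finset.sum_le_sum hterm
      _ = 26262 * (Y / L ^ 9) := by rw [Finset.sum_const, Nat.card_Icc]; norm_num; ring
  have hCsum : ∑ k ∈ Finset.range (k0f Y), TT (lamW h) h Q (Y / 2 ^ (k + 1)) (fun n => (Λ n : ℝ)) ≤ 26262 * (Y / L ^ 8) := by
    calc _ ≤ ∑ k ∈ Finset.range (k0f Y), 26262 * (Y / L ^ 9) := Finset.sum_le_sum hC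
      _ = (k0f Y : ℝ) * (26262 * (Y / L ^ 9)) := by rw [Finset.sum_const, Finset.card_range, nsmul_eq_mul]
      _ ≤ L * (26262 * (Y / L ^ 9)) := mul_le_mul_of_nonneg_right hk₀L (by positivity)
      _ = 26262 * (Y / L ^ 8) := by field_simp
  -- conclusion
  refine hsplit.trans ?_
  have hfin : Y / L ^ 7 + Y / L ^ 7 + 26262 * (Y / L ^ 8) ≤ Y / L ^ 6 := by
    have e : Y / L ^ 7 + Y / L ^ 7 + 26262 * (Y / L ^ 8) = (Y / L ^ 8) * (2 * L + 26262) := by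
      field_simp; ring
    have e' : Y / L ^ 6 = (Y / L ^ 8) * L ^ 2 := by field_simp
    rw [e, e']
    refine mul_le_mul_of_nonneg_left ?_ (by positivity)
    nlinarith
  linarith [hA, hB, hCsum, hfin]

end Core

end Summit.Parity.GeneralizedHardyLittlewood.Theorems.SieveToMAvg
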